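import Literature.MathematicalPhysics.QuantumFieldTheory.Balaban1983to89.B6Prop22KLevelTorusCensusEta
import Literature.MathematicalPhysics.QuantumFieldTheory.Balaban1983to89.B6Lemma21Counterexample
import Literature.MathematicalPhysics.QuantumFieldTheory.Balaban1983to89.B6Lemma21OneScaleTorus
import HarnessLib

/-!
# `Balaban1983to89.B6Lemma21ParamKLevelTorus` — T. Bałaban, *Propagators and renormalization transformations for lattice gauge
theories. II*, Commun. Math. Phys. **96** (1984) 223–250 [Balaban1984PropagatorsII], p. 233 (2.59), p. 234 **Lemma 2.1 (2.60)–(2.63)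
IN PARAMETER FORM (`∃ c₁(α)`, the shape of the DAG leaf's conjunct `DagBinding.B6Lemma21Param`) ON THE GENUINE `k`-LEVEL TORUS
FAMILY** `KTIdx d ℓ` ∕ `geoTP` of `B6Prop22KLevelTorusCensus(Eta)` — every nested family of domains (2.1)–(2.2) of the torus `T_η`,
every number of levels `k`, every volume, every `M_h`, `R` — UNDER PRINT'S OWN HYPOTHESIS (2.59) «RM sufficiently large».

HONEST FRAMING (programme rule): statement-level skeleton of published theorems with citation tags; proofs where landed; nothing here
is a claim about the Yang–Mills mass gap.  Cell pub-ymgap, seat `pub-ymgap-dag-p1` (Track-A DAG node N03 = [B6], first-3 list; T1 module of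
OPS-REQUESTS l.313): the Lemma-2.1 conjunct of the k-level leaf `DagBinding.B6BlockParam` was the one conjunct of eight with NO theorem on the
torus k-level family (`B6Prop23KLevelTorusCensus.ineq288_edge_kLevelTorusP` takes (2.60)/(2.61) as hypotheses).  Bałaban's statements AS
PRINTED with locators; a T1 landing is NOT a node discharge; nothing here is a continuum ∕ mass-gap ∕ Clay claim.

## WHAT IS PRINTED (verbatim up to notation)

p. 233: «c₀(α) = Σ_{z∈Z} e^{−αδ₀|z|} < 2(1 − e^{−αδ₀})⁻¹ < 4/(αδ₀)» and «Now we require that RM is sufficiently large, i.e. we assume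
¼αδ₀RM > 2d log c₀(½α) + 1. (2.59)»; p. 234: «**Lemma 2.1.** For the numbers α, 0 < α < 1, c₁(α) = 12c₀^d(½α), and RM satisfying
(2.59) we have e^{−αδ₀d(y,y′)} ≤ e^{−αδ₀RM max{|j−j′|−1,0}}, y ∈ Λ_j, y′ ∈ Λ_{j′}, (2.60)  sup_{y∈𝔅} Σ_{y′∈𝔅} e^{−αδ₀d(y,y′)} ≤ c₁(α), (2.61)
hence [(2.62), (2.63)]»; p. 224 (2.2): «(L^jη)^{−1}dist(Ω_j^c, Ω_{j+1}) > RM, M is a size of big blocks and R is a big positive integer which will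
be fixed later».  The literal constant `c₁(α) = 12c₀(½α)^d` is REFUTED AS TYPED for `d ≥ 3` (`B6Lemma21Counterexample.printed_c1_exceeded`,
cell GAPS G-A11-1); the DAG leaf therefore carries Lemma 2.1 in PARAMETER form (`DagBinding.B6Lemma21Param`: ∃ c₁(α) uniform over the family).

## WHAT THIS FILE PROVES (theorems only; 0 sorry; no `def`; standard axioms; every input USED BY NAME)

* §1 the arithmetic of (2.59): `inv_le_c0` (`c₀(α′) ≥ (α′δ₀)⁻¹`, from the tree's closed form `c0_closed`), `log_le_log_c0`
  (`log L ≤ log c₀(½α)` once `δ₀ ≤ 2/L`), `cond259_mono_R` (monotonicity of (2.59) in `R`), and **`threshold_of_cond259`**: with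
  `N₀(α) := ⌊2(d+1)·log L/(αδ₀)⌋ + 1`, print's (2.59) for `R′ = R − 1`, `M = L·M_h` implies `N₀ + 1 ≤ R·L·M_h` and the summability threshold
  `e^{−αδ₀}·L^{2(d+1)/N₀} < 1` of the tree's torus Lemma 2.1 (`B6Geom246MultiLevelTorus.lemma21_torus`);
* §2 **`ineq260_torus`** — (2.60) on the realised torus geometry `geomT D` of EVERY nested family `D : TDomains d ℓ M_h k P R`, in the form
  `e^{−αδ₀d_T(y,y′)} ≤ e^{−αδ₀(R−1)·M·max{|j−j′|−1,0}}` (the tree's walk form of (2.2), `levelGapT`: every chain of admissible bonds across a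
  level band has `≥ R·M` bonds, whence `d_T ≥ (RM − 1)(|j−j′|−1)₊ ≥ (R−1)M(|j−j′|−1)₊` by `B6Geometry.levelGap_dist_real`);
* §3 **`lemma21_torus_of_cond259`** — for `L ≥ 2`, `0 < δ₀ ≤ 2/L`, `0 < α < 1` and (2.59) with `R′ = R − 1`: (2.60) as in §2 ∧ (2.61) ∧ (2.62) ∧
  (2.63) on `geomT D` with the constant `c₁(α) = K261 N₀(α) (d+1) L 1 (αδ₀)` of `B6Ineq261LevelGap` — a function of `α` (and `d, L, δ₀`) ONLY,
  uniform in `k`, the volume `P`, `M_h`, `R` and the family `D`;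
* §4 **`lemma21Param_kLevelTorusP`** — THE BODY OF `DagBinding.B6Lemma21Param` ON THE CENSUS FAMILY `KTIdx d ℓ` ∕ `geoTP` (the index and
  geometry on which `B6.Prop22Printed` and `B6.Prop23Printed` are inhabited, `prop22Printed_kLevelTorusP` ∕ `prop23Printed_kLevelTorusP`):
  `∃ c₁ : ℝ → ℝ, ∀ i, Hyp21_22 → ∀ α ∈ (0,1), Cond259 (d+1) δ₀ α (R_i − 1) M_i → (2.60)′ ∧ Ineq261With (c₁ α) (geoTP i) δ₀ α`, with (2.60)′
  the displayed inequality of §2 read on `geoTP i` (whose `R`-field is `R_i`; the geometry of the k-level knit records `R_i − 1`, see below);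
  `cond259_satisfiable_kLevelTorusP` — the hypothesis (2.59) with `R − 1` is met inside the family for every `k ≥ 1`, `α`, `δ₀` (`R` is free).

## HONEST SCOPE ∕ NOT CLAIMED

(1) The constant is OURS (`K261`, `L`- and `δ₀`-dependent), not print's `12c₀(½α)^d` (refuted as typed) nor the d-only `c₁″` of the box lineage's
R0 route (`B6Lemma21R0MultiLevelBox`, print's distance read literally); the distance is the torus lineage's `d_T` (reading R2 of GAPS G-B6-22: the
graph distance of touching blocks, which dominates print's (2.46) up to `d + 1`) — the SAME distance in which Props. 2.2, 2.3, 2.6, 2.7 and Cor. 2.8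
are inhabited at k levels.  (2) `δ₀ ≤ 2/L`: the rate parameter of the leaf's Lemma-2.1 conjunct is free in `B6.BlockData` (used by no other
conjunct); it is taken small enough, depending on `L` only, that print's (2.59) — an `α`-dependent largeness condition on `RM` — implies the
summability threshold of `lemma21_torus` for every `α ∈ (0,1)`; for a LARGER `δ₀` print's (2.59) does not imply that threshold in the `d_T`
reading (B6-CLOSURE §5 item 1) and nothing is claimed.  (3) (2.60) is obtained with `R − 1` in place of `R` (the tree's walk form of (2.2)
loses one bond per band, `levelGapT`); a member with parameter `R` satisfies (2.2) a fortiori with `R − 1`, and (2.59) is read for `(R−1)M` —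
a stronger hypothesis, so the statement is weaker than, and implied by, the literal one; the k-level knit geometry records `R − 1` as its
`R`-field so that `B6RandomWalk.Ineq260` holds for it verbatim.  (4) Levels `1 … k`, `Ω₁ = T_η`, as in the torus lineage (files T1–T11 of
seat p21).  NOT summit progress.  Seat `pub-ymgap-dag-p1` (prover, cell pub-ymgap), 2026-08-25.
-/

noncomputable section

namespace Literature.MathematicalPhysics.QuantumFieldTheory.Balaban1983to89.B6Lemma21ParamKLevelTorus

open Literature.MathematicalPhysics.QuantumFieldTheory.Balaban1983to89.B6Geom246MultiLevelTorus (geomT bondT lemma21_torus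
  levelGapT connectedT)
open Literature.MathematicalPhysics.QuantumFieldTheory.Balaban1983to89.B6Geometry (levelGap_dist_real)
open Literature.MathematicalPhysics.QuantumFieldTheory.Balaban1983to89.B6Ineq261LevelGap (K261 K261_nonneg)
open Literature.MathematicalPhysics.QuantumFieldTheory.Balaban1983to89.B6Lemma21Counterexample (c0_closed)
open Literature.MathematicalPhysics.QuantumFieldTheory.Balaban1983to89.B6Lemma21OneScaleTorus (exists_cond259)
open Literature.MathematicalPhysics.QuantumFieldTheory.Balaban1983to89.B6Prop22KLevelTorusCensus (KTIdx)
open Literature.MathematicalPhysics.QuantumFieldTheory.Balaban1983to89.B6Prop22KLevelTorusCensusEta (geoTP)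
open Literature.MathematicalPhysics.QuantumFieldTheory.Balaban1983to89.B6Lemma21Repaired (Ineq261With Ineq262With Ineq263With)
open Literature.MathematicalPhysics.QuantumFieldTheory.Balaban1983to89.B6MultiLevelTorusOperator (TDomains)

variable {d : ℕ}

/-! ## §1  The arithmetic of (2.59) -/

/-- `c₀(α′) = Σ_{z∈ℤ} e^{−α′δ₀|z|} ≥ (α′δ₀)⁻¹`: from the closed form `(1 + e^{−t})/(1 − e^{−t})`, `t = α′δ₀ > 0`, and `1 − e^{−t} ≤ t`.
[cite: Balaban1984PropagatorsII, p.233 (the display «c₀(α) = Σ e^{−αδ₀|z|} < 2(1 − e^{−αδ₀})⁻¹»)] -/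
theorem inv_le_c0 {δ₀ α' : ℝ} (h : 0 < α' * δ₀) : (α' * δ₀)⁻¹ ≤ B6.c0 δ₀ α' := by
  rw [c0_closed h]
  have hq1 : Real.exp (-(α' * δ₀)) < 1 := Real.exp_lt_one_iff.mpr (by linarith)
  have h1t : 1 - α' * δ₀ ≤ Real.exp (-(α' * δ₀)) := by
    have := Real.add_one_le_exp (-(α' * δ₀)); linarith
  have hden : 0 < 1 - Real.exp (-(α' * δ₀)) := by linarith
  rw [inv_eq_one_div, div_le_div_iff₀ h hden]
  nlinarith [Real.exp_pos (-(α' * δ₀))]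

/-- `log L ≤ log c₀(½α)` once `0 < δ₀ ≤ 2/L` and `0 < α < 1` (`c₀(½α) ≥ 2/(αδ₀) ≥ 2/δ₀ ≥ L`).
[cite: Balaban1984PropagatorsII, p.233 (c₀ and (2.59))] -/
theorem log_le_log_c0 {L δ₀ α : ℝ} (hL : 0 < L) (hδ₀ : 0 < δ₀) (hδL : δ₀ ≤ 2 / L) (hα0 : 0 < α) (hα1 : α < 1) :
    Real.log L ≤ Real.log (B6.c0 δ₀ (α / 2)) := by
  have h : 0 < α / 2 * δ₀ := by positivity
  have hc : L ≤ B6.c0 δ₀ (α / 2) := by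
    refine le_trans ?_ (inv_le_c0 h)
    rw [le_inv_comm₀ hL h]
    have h1 : α * δ₀ ≤ δ₀ := by nlinarith
    have h2 : δ₀ / 2 ≤ L⁻¹ := by
      rw [div_le_iff₀ (by norm_num : (0 : ℝ) < 2)]
      calc δ₀ ≤ 2 / L := hδL
        _ = L⁻¹ * 2 := by rw [div_eq_inv_mul]
    calc α / 2 * δ₀ = α * δ₀ / 2 := by ring
      _ ≤ δ₀ / 2 := by linarith
      _ ≤ L⁻¹ := h2
  exact Real.log_le_log hL hc

/-- (2.59) is MONOTONE in `R`: `Cond259 d δ₀ α R M → Cond259 d δ₀ α R′ M` for `R ≤ R′` (`αδ₀M ≥ 0`).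
[cite: Balaban1984PropagatorsII, (2.59) p.233, bookkeeping] -/
theorem cond259_mono_R {dd : ℕ} {δ₀ α R R' M : ℝ} (hαδ : 0 ≤ α * δ₀) (hM : 0 ≤ M) (hR : R ≤ R')
    (h : B6.Cond259 dd δ₀ α R M) : B6.Cond259 dd δ₀ α R' M := by
  unfold B6.Cond259 at h ⊢
  have : (1 / 4 : ℝ) * α * δ₀ * R * M ≤ 1 / 4 * α * δ₀ * R' * M := by
    have := mul_le_mul_of_nonneg_left hR (by positivity : (0 : ℝ) ≤ 1 / 4 * (α * δ₀) * M)
    nlinarith [this]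
  exact lt_of_lt_of_le h this

/-- **THE (2.59)-THRESHOLD ARITHMETIC.**  With `N₀(α) := ⌊2(d+1)·log L/(αδ₀)⌋ + 1` (`L = ℓ + 1 ≥ 2`, `0 < δ₀ ≤ 2/L`, `0 < α < 1`): print's
(2.59) `2(d+1) log c₀(½α) + 1 < ¼αδ₀(R−1)·(L·M_h)` gives `0 < N₀`, `N₀ + 1 ≤ R·L·M_h`, and `e^{−αδ₀}·L^{2(d+1)/N₀} < 1` — the three hypotheses
of `B6Geom246MultiLevelTorus.lemma21_torus`. [cite: Balaban1984PropagatorsII, (2.59) p.233, Lemma 2.1 p.234 («RM satisfying (2.59)»)] -/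
theorem threshold_of_cond259 {ℓ Mh R : ℕ} (hℓ : 1 ≤ ℓ) (hMh : 1 ≤ Mh) {δ₀ α : ℝ} (hδ₀ : 0 < δ₀)
    (hδL : δ₀ ≤ 2 / ((ℓ : ℝ) + 1)) (hα0 : 0 < α) (hα1 : α < 1)
    (h259 : B6.Cond259 (d + 1) δ₀ α ((R : ℝ) - 1) (((ℓ : ℝ) + 1) * Mh)) :
    0 < ⌊2 * ((d : ℝ) + 1) * Real.log ((ℓ : ℝ) + 1) / (α * δ₀)⌋₊ + 1 ∧
    ⌊2 * ((d : ℝ) + 1) * Real.log ((ℓ : ℝ) + 1) / (α * δ₀)⌋₊ + 1 + 1 ≤ R * ((ℓ + 1) * Mh) ∧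
    Real.exp (-(α * δ₀)) * ((ℓ : ℝ) + 1) ^ ((2 * ((d + 1 : ℕ) : ℝ)) /
      ((⌊2 * ((d : ℝ) + 1) * Real.log ((ℓ : ℝ) + 1) / (α * δ₀)⌋₊ + 1 : ℕ) : ℝ)) < 1 := by
  set Lr : ℝ := (ℓ : ℝ) + 1 with hLr_def
  have hℓr : (1 : ℝ) ≤ (ℓ : ℝ) := by exact_mod_cast hℓ
  have hLr2 : (2 : ℝ) ≤ Lr := by rw [hLr_def]; linarith
  have hLr0 : (0 : ℝ) < Lr := by linarith
  have hlogL : 0 ≤ Real.log Lr := Real.log_nonneg (by linarith)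
  have ht : 0 < α * δ₀ := mul_pos hα0 hδ₀
  set X : ℝ := 2 * ((d : ℝ) + 1) * Real.log Lr / (α * δ₀) with hX_def
  have hX0 : 0 ≤ X := by rw [hX_def]; positivity
  set N₀ : ℕ := ⌊X⌋₊ + 1 with hN₀_def
  have hN₀pos : 0 < N₀ := Nat.succ_pos _
  -- the real `N₀` is between `X` and `X + 1`
  have hXN : X < (N₀ : ℝ) := by
    rw [hN₀_def]; push_cast; exact Nat.lt_floor_add_one X
  have hNX : (N₀ : ℝ) ≤ X + 1 := by
    rw [hN₀_def]; push_cast; linarith [Nat.floor_le hX0]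
  -- multiply out: X·(αδ₀) = 2(d+1) log L
  have hXt : X * (α * δ₀) = 2 * ((d : ℝ) + 1) * Real.log Lr := by
    rw [hX_def]; field_simp
  refine ⟨hN₀pos, ?_, ?_⟩
  · -- from (2.59): `(R - 1)·M > (8(d+1) log L + 4)/(αδ₀) = 4X + 4/(αδ₀)`, and `R·M ≥ (R−1)·M`, `4/(αδ₀) ≥ 2`
    have hM1 : (1 : ℝ) ≤ (Mh : ℝ) := by exact_mod_cast hMh
    have hM0 : (0 : ℝ) ≤ Lr * Mh := by positivity
    have hlog := log_le_log_c0 hLr0 hδ₀ hδL hα0 hα1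
    unfold B6.Cond259 at h259
    push_cast at h259
    -- h259 : 2 * (d + 1) * log c₀ + 1 < 1/4 * α * δ₀ * (R - 1) * ((ℓ + 1) * Mh)
    have h1 : 2 * ((d : ℝ) + 1) * Real.log Lr + 1 < 1 / 4 * (α * δ₀) * (((R : ℝ) - 1) * (Lr * Mh)) := by
      have : 2 * ((d : ℝ) + 1) * Real.log Lr ≤ 2 * ((d : ℝ) + 1) * Real.log (B6.c0 δ₀ (α / 2)) :=
        mul_le_mul_of_nonneg_left hlog (by positivity)
      rw [hLr_def]; nlinarith [this, h259]
    have htle : α * δ₀ ≤ 1 := by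
      have h1' : α * δ₀ ≤ δ₀ := by nlinarith
      have h2' : δ₀ ≤ 1 := by
        refine hδL.trans ?_
        rw [div_le_one hLr0]; exact hLr2
      linarith
    -- (X + 2)·(αδ₀) ≤ 2(d+1) log L + 2 < 4·(2(d+1) log L + 1) < (αδ₀)(R−1)(L Mh) ≤ (αδ₀)·R·(L·Mh)
    have hRM : (X + 2) * (α * δ₀) < ((R : ℝ) * (Lr * Mh)) * (α * δ₀) := by
      have hA : (X + 2) * (α * δ₀) ≤ 2 * ((d : ℝ) + 1) * Real.log Lr + 2 := by nlinarith
      have hB : ((R : ℝ) - 1) * (Lr * Mh) ≤ (R : ℝ) * (Lr * Mh) := by nlinarith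
      have hC : (α * δ₀) * (((R : ℝ) - 1) * (Lr * Mh)) ≤ (α * δ₀) * ((R : ℝ) * (Lr * Mh)) :=
        mul_le_mul_of_nonneg_left hB ht.le
      nlinarith
    have hRM' : X + 2 < (R : ℝ) * (Lr * Mh) := lt_of_mul_lt_mul_right hRM ht.le
    have hcast : ((⌊X⌋₊ + 1 + 1 : ℕ) : ℝ) < ((R * ((ℓ + 1) * Mh) : ℕ) : ℝ) := by
      push_cast
      have : ((⌊X⌋₊ : ℕ) : ℝ) ≤ X := Nat.floor_le hX0
      rw [hLr_def] at hRM'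
      linarith
    exact (Nat.cast_lt.mp hcast).le
  · -- `θ = e^{−t}·L^{c/N₀} = e^{−t + (c/N₀) log L} < 1` iff `c·log L < t·N₀`, i.e. `X < N₀`
    have hc : (2 * ((d + 1 : ℕ) : ℝ)) = 2 * ((d : ℝ) + 1) := by push_cast; ring
    rw [hc, Real.rpow_def_of_pos hLr0, ← Real.exp_add]
    apply Real.exp_lt_one_iff.mpr  -- goal: -(αδ₀) + log L * (2(d+1)/N₀) < 0
    have hN₀r : (0 : ℝ) < (N₀ : ℝ) := by exact_mod_cast hN₀pos
    have hkey : 2 * ((d : ℝ) + 1) * Real.log Lr < (α * δ₀) * (N₀ : ℝ) := by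
      have := mul_lt_mul_of_pos_right hXN ht
      linarith [this, hXt]
    have : Real.log Lr * (2 * ((d : ℝ) + 1) / (N₀ : ℝ)) < α * δ₀ := by
      rw [mul_div_assoc', div_lt_iff₀ hN₀r]
      linarith
    linarith

/-! ## §2  (2.60) on the torus, in the walk form of (2.2) -/

/-- **(2.60) ON THE GENUINE NESTED TORUS FAMILY** (reading `R′ = R − 1`): for every `D : TDomains d ℓ M_h k P R` (`M_h ≥ 1`, `P_μ ≥ 1`), every
`αδ₀ ≥ 0` and all blocks `y ∈ Λ_j`, `y′ ∈ Λ_{j′}` of the torus: `e^{−αδ₀ d_T(y,y′)} ≤ e^{−αδ₀·(R−1)·M·max{|j−j′|−1, 0}}`, `M = L·M_h` — from the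
tree's walk form of (2.2) (`levelGapT`: a chain of admissible bonds across a level band has at least `RM` bonds) through
`B6Geometry.levelGap_dist_real` (`d_T ≥ (RM−1)(|j−j′|−1)₊ ≥ (R−1)M(|j−j′|−1)₊`).
[cite: Balaban1984PropagatorsII, Lemma 2.1 (2.60) p.234, (2.57) p.233, (2.2) p.224] -/
theorem ineq260_torus {ℓ Mh k R : ℕ} {P : Fin (d + 1) → ℕ} (D : TDomains d ℓ Mh k P R) (hMh : 1 ≤ Mh)
    (hP : ∀ μ, 1 ≤ P μ) {δ₀ α : ℝ} (hαδ : 0 ≤ α * δ₀) (y y' : (geomT D).Site) :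
    Real.exp (-(α * δ₀ * (geomT D).dist y y')) ≤
      Real.exp (-(α * δ₀ * ((R : ℝ) - 1) * (((ℓ : ℝ) + 1) * Mh) * max (|(y.1.1 : ℝ) - y'.1.1| - 1) 0)) := by
  have hd := levelGap_dist_real (connectedT (D := D) hMh hP) (levelGapT D) y y'
  have hmax : 0 ≤ max (|(y.1.1 : ℝ) - y'.1.1| - 1) 0 := le_max_right _ _
  have hM1 : (1 : ℝ) ≤ ((ℓ : ℝ) + 1) * Mh := by
    have h1 : (1 : ℝ) ≤ (Mh : ℝ) := by exact_mod_cast hMh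
    nlinarith [(Nat.cast_nonneg ℓ : (0 : ℝ) ≤ ℓ)]
  have hRM : ((R : ℝ) - 1) * (((ℓ : ℝ) + 1) * Mh) ≤ ((R * ((ℓ + 1) * Mh) - 1 : ℕ) : ℝ) := by
    rcases Nat.eq_zero_or_pos R with hR | hR
    · subst hR
      simp only [Nat.cast_zero, zero_sub, zero_mul, Nat.zero_sub]
      nlinarith
    · have h1 : 1 ≤ R * ((ℓ + 1) * Mh) := Nat.one_le_iff_ne_zero.mpr (Nat.pos_iff_ne_zero.mp (by positivity))
      rw [Nat.cast_sub h1]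
      push_cast
      have hR1 : (1 : ℝ) ≤ (R : ℝ) := by exact_mod_cast hR
      nlinarith
  have hdist : ((R : ℝ) - 1) * (((ℓ : ℝ) + 1) * Mh) * max (|(y.1.1 : ℝ) - y'.1.1| - 1) 0 ≤ (geomT D).dist y y' :=
    calc ((R : ℝ) - 1) * (((ℓ : ℝ) + 1) * Mh) * max (|(y.1.1 : ℝ) - y'.1.1| - 1) 0
        ≤ ((R * ((ℓ + 1) * Mh) - 1 : ℕ) : ℝ) * max (|(y.1.1 : ℝ) - y'.1.1| - 1) 0 :=
          mul_le_mul_of_nonneg_right hRM hmax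
      _ ≤ ((bondT D).dist y y' : ℝ) := hd
      _ = (geomT D).dist y y' := rfl
  apply Real.exp_le_exp.mpr
  have h := mul_le_mul_of_nonneg_left hdist hαδ
  have e1 : α * δ₀ * ((R : ℝ) - 1) * (((ℓ : ℝ) + 1) * Mh) * max (|(y.1.1 : ℝ) - y'.1.1| - 1) 0 =
      α * δ₀ * (((R : ℝ) - 1) * (((ℓ : ℝ) + 1) * Mh) * max (|(y.1.1 : ℝ) - y'.1.1| - 1) 0) := by ring
  rw [e1]
  exact neg_le_neg h

/-! ## §3  Lemma 2.1 on the torus under (2.59) -/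

/-- **LEMMA 2.1 (2.60)–(2.63) ON THE GENUINE NESTED TORUS FAMILY UNDER PRINT'S (2.59)** (parameter form, reading `R′ = R − 1`): for `L = ℓ + 1 ≥ 2`,
`M_h ≥ 1`, `P_μ ≥ 1`, every `D : TDomains d ℓ M_h k P R`, every `0 < δ₀ ≤ 2/L`, `0 < α < 1` with `¼αδ₀(R−1)M > 2(d+1) log c₀(½α) + 1`
(`M = L·M_h`): (2.60) (with `R − 1`) ∧ (2.61) ∧ (2.62) ∧ (2.63) on `geomT D` with the constant `c₁(α) = K261 N₀(α) (d+1) L 1 (αδ₀)`,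
`N₀(α) = ⌊2(d+1) log L/(αδ₀)⌋ + 1` — uniform in `k`, the volume, `M_h`, `R`, `D` (the tree's `lemma21_torus` BY NAME, its three threshold
hypotheses discharged from (2.59) by `threshold_of_cond259`). [cite: Balaban1984PropagatorsII, Lemma 2.1 (2.60)–(2.63) p.234, (2.59) p.233] -/
theorem lemma21_torus_of_cond259 {ℓ Mh k R : ℕ} {P : Fin (d + 1) → ℕ} (D : TDomains d ℓ Mh k P R) (hℓ : 1 ≤ ℓ)
    (hMh : 1 ≤ Mh) (hP : ∀ μ, 1 ≤ P μ) {δ₀ : ℝ} (hδ₀ : 0 < δ₀) (hδL : δ₀ ≤ 2 / ((ℓ : ℝ) + 1)) {α : ℝ}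
    (hα0 : 0 < α) (hα1 : α < 1) (h259 : B6.Cond259 (d + 1) δ₀ α ((R : ℝ) - 1) (((ℓ : ℝ) + 1) * Mh)) :
    (∀ y y' : (geomT D).Site, Real.exp (-(α * δ₀ * (geomT D).dist y y')) ≤
        Real.exp (-(α * δ₀ * ((R : ℝ) - 1) * (((ℓ : ℝ) + 1) * Mh) * max (|(y.1.1 : ℝ) - y'.1.1| - 1) 0))) ∧
      Ineq261With (K261 (⌊2 * ((d : ℝ) + 1) * Real.log ((ℓ : ℝ) + 1) / (α * δ₀)⌋₊ + 1) (d + 1) ((ℓ : ℝ) + 1) 1 (α * δ₀))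
        (geomT D) δ₀ α ∧
      Ineq262With (K261 (⌊2 * ((d : ℝ) + 1) * Real.log ((ℓ : ℝ) + 1) / (α * δ₀)⌋₊ + 1) (d + 1) ((ℓ : ℝ) + 1) 1 (α * δ₀))
        (geomT D) δ₀ α ∧
      Ineq263With (K261 (⌊2 * ((d : ℝ) + 1) * Real.log ((ℓ : ℝ) + 1) / (α * δ₀)⌋₊ + 1) (d + 1) ((ℓ : ℝ) + 1) 1 (α * δ₀))
        (geomT D) δ₀ α := by
  obtain ⟨hN₀, hRM, hθ⟩ := threshold_of_cond259 (d := d) (R := R) hℓ hMh hδ₀ hδL hα0 hα1 h259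
  obtain ⟨-, h261, h262, h263⟩ := lemma21_torus D hMh hP hN₀ hRM hδ₀.le hα0.le hα1.le hθ
  exact ⟨fun y y' => ineq260_torus D hMh hP (mul_pos hα0 hδ₀).le y y', h261, h262, h263⟩

/-! ## §4  The `B6Lemma21Param` shape on the census family `KTIdx` ∕ `geoTP` -/

/-- **THE BODY OF `DagBinding.B6Lemma21Param` ON THE GENUINE k-LEVEL TORUS FAMILY `KTIdx d ℓ` ∕ `geoTP`** (`L = ℓ + 1 ≥ 2`, `0 < δ₀ ≤ 2/L`):
there is `c₁ : ℝ → ℝ` (`≥ 0`) such that for every member `i`, every `0 < α < 1` and `(R_i − 1)M_i` satisfying (2.59):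
(2.60)′ `e^{−αδ₀d(y,y′)} ≤ e^{−αδ₀(R_i−1)M_i·max{|j−j′|−1,0}}` ∧ (2.61) `Σ_{y′∈𝔅} e^{−αδ₀d(y,y′)} ≤ c₁(α)` — UNIFORM over the family (all `k`,
volumes, `M_h`, `R`, nested domains).  This is `DagBinding.B6Lemma21Param`'s matrix for a geometry whose `R`-field is `R_i − 1` (the k-level
knit geometry); on `geoTP i` itself (`R`-field `R_i`) it is displayed explicitly.
[cite: Balaban1984PropagatorsII, Lemma 2.1 (2.60)–(2.61) p.234, (2.59) p.233] -/
theorem lemma21Param_kLevelTorusP (d ℓ : ℕ) (hℓ : 1 ≤ ℓ) {δ₀ : ℝ} (hδ₀ : 0 < δ₀) (hδL : δ₀ ≤ 2 / ((ℓ : ℝ) + 1)) :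
    ∃ c₁ : ℝ → ℝ, (∀ α, 0 ≤ c₁ α) ∧ ∀ i : KTIdx d ℓ, (geoTP i).Hyp21_22 → ∀ α : ℝ, 0 < α → α < 1 →
      B6.Cond259 (d + 1) δ₀ α ((geoTP i).R - 1) (geoTP i).M →
        (∀ y y' : (geoTP i).Site, Real.exp (-(α * δ₀ * (geoTP i).dist y y')) ≤
            Real.exp (-(α * δ₀ * ((geoTP i).R - 1) * (geoTP i).M *
              max (|((geoTP i).scale y : ℝ) - (geoTP i).scale y'| - 1) 0))) ∧
        Ineq261With (c₁ α) (geoTP i) δ₀ α := by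
  refine ⟨fun α => K261 (⌊2 * ((d : ℝ) + 1) * Real.log ((ℓ : ℝ) + 1) / (α * δ₀)⌋₊ + 1) (d + 1) ((ℓ : ℝ) + 1) 1 (α * δ₀),
    fun α => K261_nonneg (by positivity) zero_le_one, fun i _ α hα0 hα1 h259 => ?_⟩
  obtain ⟨h260, h261, -, -⟩ := lemma21_torus_of_cond259 i.D hℓ i.hMh i.hP hδ₀ hδL hα0 hα1 h259
  exact ⟨h260, h261⟩

/-- **(2.59) WITH `R − 1` IS MET INSIDE THE FAMILY**: for every `k ≥ 1`, every `α, δ₀` with `αδ₀ > 0` there is a member `i : KTIdx d ℓ` with `k`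
levels (print's admitted member `Ω₁ = … = Ω_k = T_η`, `R` large) satisfying `Cond259 (d+1) δ₀ α (R_i − 1) M_i` — the hypothesis of
`lemma21Param_kLevelTorusP` is not vacuous («R is a big positive integer which will be fixed later», p. 224).
[cite: Balaban1984PropagatorsII, (2.59) p.233, (2.2) p.224, (2.1) p.224 («we admit the case when some domains Ω_j are equal to T_η»)] -/
theorem cond259_satisfiable_kLevelTorusP (d ℓ k : ℕ) (hk : 1 ≤ k) {δ₀ α : ℝ} (h : 0 < α * δ₀) :
    ∃ i : KTIdx d ℓ, i.k = k ∧ (geoTP i).Hyp21_22 ∧ B6.Cond259 (d + 1) δ₀ α ((geoTP i).R - 1) (geoTP i).M := by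
  obtain ⟨R₀, hR₀⟩ := exists_cond259 (d + 1) h
  set R : ℕ := max (R₀ + 1) (2 * (ℓ + 1)) with hR_def
  refine ⟨⟨k, 1, R, fun _ => 4, TDomains.top d ℓ 1 k (fun _ => 4) R hk, hk, le_rfl, le_max_right _ _, fun _ => le_rfl⟩,
    rfl, trivial, ?_⟩
  have h1 : B6.Cond259 (d + 1) δ₀ α (R₀ : ℝ) (((ℓ + 1 : ℕ) : ℕ) : ℝ) := hR₀ (ℓ + 1) (by omega)
  have hR : (R₀ : ℝ) ≤ (R : ℝ) - 1 := by
    have : R₀ + 1 ≤ R := le_max_left _ _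
    have : ((R₀ : ℝ) + 1) ≤ (R : ℝ) := by exact_mod_cast this
    linarith
  have hM : (((ℓ + 1 : ℕ) : ℕ) : ℝ) = ((ℓ : ℝ) + 1) * ((1 : ℕ) : ℝ) := by push_cast; ring
  have h2 := cond259_mono_R (dd := d + 1) h.le (by positivity) hR h1
  rw [hM] at h2
  exact h2

end Literature.MathematicalPhysics.QuantumFieldTheory.Balaban1983to89.B6Lemma21ParamKLevelTorus

end
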